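import Literature.AlgebraicGeometry.AbelianSchemes.RigidifiedLineBundleToBaseChange
import Literature.AlgebraicGeometry.AbelianSchemes.PoincareUniversalLocality
import HarnessLib

/-!
# (Z3) FILE P-b, letter (U): UNIQUENESS of classifying maps into a glued hat with chart data

Layer `Literature/AlgebraicGeometry/AbelianSchemes`, namespace `Literature.AlgebraicGeometry.AbelianSchemes.AbelianSchemeOver`.
One definition with body (`prodChart`, the product charts — non-Prop plumbing) + theorems; no structure, no named fact, no
instance, no notation, no `sorry`.  Cell hodgecm-mathlib (D-0151), FLOOR 0 P1 sub-line `Cruxes/HDel/Lines/F3DualAbelianScheme.lean`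
stub (Z) `stub_F3Z`; FILE P-b of `B-provers/B-p06/g14/F3/SOCKETS-F3Z-FileP.B-p06g14.md`, letter (U) of the skeleton
`DualPairOfGluedHat.SKELETON-4sorry.B-p06g14.lean` (B-p06 (g14)), discharged here.

SETTING ([MumfordFogartyKirwan1994, Cor. 6.8]; [MilneAV2008, I §8]).  `A → S` an abelian scheme over a LOCALLY NOETHERIAN `S`,
`𝒰 = (Uᵢ → S)` an open cover, `Eᵢ` a dual pair of `Aᵢ := A ×_S Uᵢ` for every `i`; `H → S` an abelian scheme with CARTESIAN charts
`χᵢ : Êᵢ → H` over `Uᵢ → S` (★ `IsBaseChangeVia`; produced by FILE H `exists_gluedHat`); `P′` a module on `A ×_S H` whose pull-back along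
every product chart `Ξᵢ := pr_A × χᵢ : Aᵢ ×_{Uᵢ} Êᵢ → A ×_S H` is the chart Poincaré sheaf `𝒫ᵢ` (produced by the (Z1) glueing engine).

* `prodChart i = Ξᵢ` (`pullback.map`); `bcHomLeft_comp_baseChangeToProd_comp_prodChart` — for `T ⊇ Tᵢ := T ×_S Uᵢ →[ι] T` and an
  `S`-map `g : T → H` with chart lift `γ : Tᵢ → Êᵢ` (`γ ≫ χᵢ = ι ≫ g`), the square
  `A_{Tᵢ} ≅ (Aᵢ)_{Tᵢ} →(1 × γ) Aᵢ × Êᵢ →Ξᵢ A × H` = `A_{Tᵢ} →(1 × ι) A_T →(1 × g) A × H` (Mathlib `pullback.hom_ext`);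
* `nonempty_pullbackP_chartLift_iso` — hence `(1 × γ)^*𝒫ᵢ ≅ (ℒ|_{Tᵢ}` read on `(Aᵢ)_{Tᵢ}`)` whenever `(1 × g)^*P′ ≅ ℒ`
  (★ `restrictSolutionIso`, ★ `RigidifiedLineBundle.toBaseChange` / `nonempty_iso_toBaseChange_L_iff`);
* **`eq_of_nonempty_pullbackToProd_iso_of_charts`** — letter (U): two `S`-morphisms `g, g′ : T → H` with `(1 × g)^*P′ ≅ ℒ ≅ (1 × g′)^*P′`
  for a rigidified fibrewise-`Pic⁰` family `ℒ` on `A_T` are EQUAL: on `Tᵢ` both lift to `Êᵢ` through the cartesian `χᵢ`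
  (Mathlib `IsPullback.lift`) and classify the same family for `Eᵢ` (★ `DualPair.eq_of_nonempty_iso`), and the `Tᵢ` cover `T`
  (Mathlib `Scheme.Cover.hom_ext` on `𝒰.pullback₁ f`).

HC_CM is proved only modulo the 7 printed citations until rung 0 closes; this file discharges none of them (count-neutral capital).

## References
* [MilneAV2008] J. S. Milne, *Abelian Varieties* (v2.00, 2008), I §8 pp. 36–37 (the dual pair: uniqueness of the classifying map).
* [MumfordFogartyKirwan1994] D. Mumford, J. Fogarty, F. Kirwan, *Geometric Invariant Theory*, 3rd ed. (1994), Ch. 6 §1 Cor. 6.8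
  (p. 118); Ch. 7 §2 Def. 7.2 (p. 129).
* [GortzWedhorn2020] U. Görtz, T. Wedhorn, *Algebraic Geometry I*, 2nd ed. (2020), Section (3.3) Prop. 3.5, Prop. 4.16 (p. 101).
-/

set_option autoImplicit false

-- `Scheme.Modules` / the `Over`-structure maps of ★ `baseChange` are not reducible (as in ★ `PoincareUniversalLocality`).
set_option backward.isDefEq.respectTransparency false

noncomputable section

universe u

open CategoryTheory CategoryTheory.Limits AlgebraicGeometry MonoidalCategory
open Literature.AlgebraicGeometry.Motives Literature.AlgebraicGeometry.AbelianVarieties Literature.AlgebraicGeometry.Modules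

namespace Literature.AlgebraicGeometry.AbelianSchemes

namespace AbelianSchemeOver

variable {S : Scheme.{u}} (A : AbelianSchemeOver S) (𝒰 : Scheme.OpenCover.{u} S)
  (E : ∀ i, (A.baseChange (𝒰.f i)).DualPair) (H : AbelianSchemeOver S) (χ : ∀ i, (E i).hat.X.left ⟶ H.X.left)
  (hχ : ∀ i, (E i).hat.IsBaseChangeVia H (𝒰.f i) (χ i))

/-! ### The product charts -/

/-- **The product chart** `Ξᵢ : Aᵢ ×_{Uᵢ} Êᵢ → A ×_S H` (`pr_A × χᵢ` over `Uᵢ → S`; non-Prop plumbing, Mathlib `pullback.map`).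
[cite: MumfordFogartyKirwan1994, Ch. 7 §2 Definition 7.2 (p. 129)] -/
def prodChart (i : 𝒰.I₀) : (A.baseChange (𝒰.f i)).prodLeft (E i).hat ⟶ A.prodLeft H :=
  pullback.map (A.baseChange (𝒰.f i)).X.hom (E i).hat.X.hom A.X.hom H.X.hom (pullback.fst A.X.hom (𝒰.f i)) (χ i) (𝒰.f i)
    pullback.condition.symm (hχ i).fst.symm

/-- `Ξᵢ ≫ pr_A = pr ≫ (Aᵢ → A)`. [cite: MumfordFogartyKirwan1994, Ch. 7 §2 Definition 7.2 (p. 129)] -/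
@[reassoc]
theorem prodChart_fst (i : 𝒰.I₀) :
    A.prodChart 𝒰 E H χ hχ i ≫ pullback.fst A.X.hom H.X.hom =
      pullback.fst (A.baseChange (𝒰.f i)).X.hom (E i).hat.X.hom ≫ pullback.fst A.X.hom (𝒰.f i) :=
  pullback.lift_fst _ _ _

/-- `Ξᵢ ≫ pr_H = pr ≫ χᵢ`. [cite: MumfordFogartyKirwan1994, Ch. 7 §2 Definition 7.2 (p. 129)] -/
@[reassoc]
theorem prodChart_snd (i : 𝒰.I₀) :
    A.prodChart 𝒰 E H χ hχ i ≫ pullback.snd A.X.hom H.X.hom =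
      pullback.snd (A.baseChange (𝒰.f i)).X.hom (E i).hat.X.hom ≫ χ i :=
  pullback.lift_snd _ _ _

/-! ### Chart lifts of classifying maps and the restricted solutions -/

section ChartLift

variable {A 𝒰 E H χ} {T T₁ : Scheme.{u}} {f : T ⟶ S} (i : 𝒰.I₀) (ι : T₁ ⟶ T) (t : T₁ ⟶ 𝒰.X i)
  (hιt : ι ≫ f = t ≫ 𝒰.f i) (g : T ⟶ H.X.left) (hg : g ≫ H.X.hom = f) (γ : T₁ ⟶ (E i).hat.X.left)
  (hγχ : γ ≫ χ i = ι ≫ g) (hγt : γ ≫ (E i).hat.X.hom = t)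

include hγχ in
/-- **The chart square**: `e ≫ (1 × γ) ≫ Ξᵢ = (1 × ι) ≫ (1 × g)` as maps `A_{T₁} → A ×_S H`, where `e : A_{t ≫ (Uᵢ → S)} ≅ (Aᵢ)_{t}`
is ★ `bcHomLeft` (components in `A` by ★ `baseChangeCompGrpIso_hom_left_fst_fst`, in `H` through `γ ≫ χᵢ = ι ≫ g`).
[cite: GortzWedhorn2020, Prop. 4.16 (p. 101)] [cite: MumfordFogartyKirwan1994, Ch. 7 §2 Definition 7.2 (p. 129)] -/
theorem bcHomLeft_comp_baseChangeToProd_comp_prodChart :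
    A.bcHomLeft (𝒰.f i) t ≫ (A.baseChange (𝒰.f i)).baseChangeToProd (E i).hat t γ hγt ≫ A.prodChart 𝒰 E H χ hχ i =
      A.prodMap (t ≫ 𝒰.f i) f ι hιt ≫ A.baseChangeToProd H f g hg := by
  apply pullback.hom_ext
  · rw [Category.assoc, Category.assoc, prodChart_fst, baseChangeToProd_fst_assoc, Category.assoc, baseChangeToProd_fst,
      prodMap_fst]
    exact A.baseChangeCompGrpIso_hom_left_fst_fst (𝒰.f i) t
  · rw [Category.assoc, Category.assoc, prodChart_snd, baseChangeToProd_snd_assoc, Category.assoc, baseChangeToProd_snd,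
      prodMap_snd_assoc, hγχ]
    exact (A.baseChangeCompGrpIso_hom_left_snd_assoc (𝒰.f i) t (ι ≫ g))

include hγχ in
/-- **Restricted solutions on the chart**: if `(1 × g)^*P′ ≅ ℒ` on `A_T` and `Ξᵢ^*P′ ≅ 𝒫ᵢ`, then the chart lift `γ` classifies the
restriction of `ℒ` to `T₁`, read as a family for `Aᵢ` (★ `RigidifiedLineBundle.toBaseChange` of ★ `comapAlong`):
`(1 × γ)^*𝒫ᵢ ≅ ((ℒ.comapAlong ι).toBaseChange).L`. [cite: MilneAV2008, I §8 pp. 36–37] -/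
theorem nonempty_pullbackP_chartLift_iso (P' : (A.prodLeft H).Modules)
    (hPi : Nonempty ((Scheme.Modules.pullback (A.prodChart 𝒰 E H χ hχ i)).obj P' ≅ (E i).P))
    (ℒ : A.RigidifiedLineBundle f)
    (h : Nonempty ((Scheme.Modules.pullback (A.baseChangeToProd H f g hg)).obj P' ≅ ℒ.L)) :
    Nonempty ((E i).pullbackP t γ hγt ≅ ((ℒ.comapAlong ι hιt).toBaseChange).L) := by
  obtain ⟨c⟩ := hPi
  obtain ⟨e⟩ := h
  refine ((ℒ.comapAlong ι hιt).nonempty_iso_toBaseChange_L_iff _).2 ⟨?_⟩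
  -- `e^* (1 × γ)^* 𝒫ᵢ ≅ e^* (1 × γ)^* Ξᵢ^* P′ ≅ (e ≫ (1 × γ) ≫ Ξᵢ)^* P′ = ((1 × ι) ≫ (1 × g))^* P′ ≅ (1 × ι)^* (1 × g)^* P′ ≅ (1 × ι)^* ℒ`
  refine (Scheme.Modules.pullback (A.bcHomLeft (𝒰.f i) t)).mapIso
      ((Scheme.Modules.pullback ((A.baseChange (𝒰.f i)).baseChangeToProd (E i).hat t γ hγt)).mapIso c.symm ≪≫
        (Scheme.Modules.pullbackComp _ _).app P') ≪≫
    (Scheme.Modules.pullbackComp _ _).app P' ≪≫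
    (Scheme.Modules.pullbackCongr ?_).app P' ≪≫
    ((Scheme.Modules.pullbackComp _ _).app P').symm ≪≫
    (Scheme.Modules.pullback (A.prodMap (t ≫ 𝒰.f i) f ι hιt)).mapIso e
  exact bcHomLeft_comp_baseChangeToProd_comp_prodChart hχ i ι t hιt g hg γ hγχ hγt

end ChartLift

/-! ### Letter (U): uniqueness of classifying maps into the glued hat -/

/-- **Letter (U) — UNIQUENESS OF CLASSIFYING MAPS INTO A GLUED HAT.**  Let `P′` on `A ×_S H` have the chart Poincaré sheaves as
chart pull-backs (`Ξᵢ^*P′ ≅ 𝒫ᵢ`).  If two `S`-morphisms `g, g′ : T → H` both satisfy `(1 × g)^*P′ ≅ ℒ`, `(1 × g′)^*P′ ≅ ℒ` for a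
rigidified fibrewise-`Pic⁰` line bundle `ℒ` on `A_T`, then `g = g′`: on `Tᵢ = T ×_S Uᵢ` both lift to `Êᵢ` through the CARTESIAN
chart `χᵢ` (Mathlib `IsPullback.lift`), the lifts classify the same family `ℒ|_{Tᵢ}` for the dual pair `Eᵢ`
(`nonempty_pullbackP_chartLift_iso`) and hence coincide ([MilneAV2008, I §8] «unique», ★ `DualPair.eq_of_nonempty_iso`); the
`Tᵢ` cover `T` (Mathlib `Scheme.Cover.hom_ext`). [cite: MilneAV2008, I §8 pp. 36–37] [cite: GortzWedhorn2020, Section (3.3) Proposition 3.5] -/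
theorem eq_of_nonempty_pullbackToProd_iso_of_charts (P' : (A.prodLeft H).Modules)
    (hP : ∀ i, Nonempty ((Scheme.Modules.pullback (A.prodChart 𝒰 E H χ hχ i)).obj P' ≅ (E i).P))
    {T : Scheme.{u}} (f : T ⟶ S) (ℒ : A.RigidifiedLineBundle f) (hℒ : ℒ.FibrewisePicZero)
    (g g' : T ⟶ H.X.left) (hg : g ≫ H.X.hom = f) (hg' : g' ≫ H.X.hom = f)
    (h : Nonempty ((Scheme.Modules.pullback (A.baseChangeToProd H f g hg)).obj P' ≅ ℒ.L))
    (h' : Nonempty ((Scheme.Modules.pullback (A.baseChangeToProd H f g' hg')).obj P' ≅ ℒ.L)) : g = g' := by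
  refine Scheme.Cover.hom_ext (𝒰.pullback₁ f) _ _ fun (i : 𝒰.I₀) => ?_
  show pullback.fst f (𝒰.f i) ≫ g = pullback.fst f (𝒰.f i) ≫ g'
  -- the chart `Tᵢ = T ×_S Uᵢ`, `ι : Tᵢ → T`, `t : Tᵢ → Uᵢ`
  set ι := pullback.fst f (𝒰.f i) with hι
  set t := pullback.snd f (𝒰.f i) with ht
  have hιt : ι ≫ f = t ≫ 𝒰.f i := pullback.condition
  obtain ⟨w, hpb, -, -⟩ := hχ i
  -- the chart lifts of `g` and `g′` through the cartesian `χᵢ`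
  have wg : (ι ≫ g) ≫ H.X.hom = t ≫ 𝒰.f i := by rw [Category.assoc, hg, hιt]
  have wg' : (ι ≫ g') ≫ H.X.hom = t ≫ 𝒰.f i := by rw [Category.assoc, hg', hιt]
  let γ := hpb.lift (ι ≫ g) t wg
  let γ' := hpb.lift (ι ≫ g') t wg'
  have hγχ : γ ≫ χ i = ι ≫ g := hpb.lift_fst _ _ _
  have hγ'χ : γ' ≫ χ i = ι ≫ g' := hpb.lift_fst _ _ _
  have hγt : γ ≫ (E i).hat.X.hom = t := hpb.lift_snd _ _ _
  have hγ't : γ' ≫ (E i).hat.X.hom = t := hpb.lift_snd _ _ _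
  -- both classify `ℒ|_{Tᵢ}` (read as a family for `Aᵢ`) for the dual pair `Eᵢ`
  have hfam : ((ℒ.comapAlong ι hιt).toBaseChange).FibrewisePicZero :=
    RigidifiedLineBundle.toBaseChange_fibrewisePicZero (RigidifiedLineBundle.comapAlong_fibrewisePicZero hℒ ι hιt)
  have e₁ := nonempty_pullbackP_chartLift_iso hχ i ι t hιt g hg γ hγχ hγt P' (hP i) ℒ h
  have e₂ := nonempty_pullbackP_chartLift_iso hχ i ι t hιt g' hg' γ' hγ'χ hγ't P' (hP i) ℒ h'
  have hγγ' : γ = γ' := (E i).eq_of_nonempty_iso t _ hfam γ γ' hγt hγ't e₁ e₂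
  rw [← hγχ, ← hγ'χ, hγγ']

end AbelianSchemeOver

end Literature.AlgebraicGeometry.AbelianSchemes

end
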